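import Literature.AlgebraicGeometry.HodgeTheory.TangentSheafSectionsDerivations
import HarnessLib

/-!
# Coordinates of derivations in a coframe: `Der_S(Γ(V, 𝒪_X), N) = N^I` on the affine opens under a frame
# `𝒪^I ≅ Ω¹_{X/S}|_W`

Layer `Literature/AlgebraicGeometry/HodgeTheory` (cell hodgecm-mathlib, F-4 `stub_IIaE` ∕ F-11 (A4b) «(E) of [MFK94]
Prop. 6.15», brick C1 of `B-provers/B-p01/g16/SOCKETS-A4b-FileA-E.v0`; count-neutral generic capital).  THEOREMS ONLY
(no definition, no named fact, no instance, no notation).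

For an `S`-scheme `X : Over (Spec S)` with a FRAME `e : 𝒪^I ≅ Ω¹_{X/S}|_W` of the cotangent sheaf over an open `W`
(`I` finite; e.g. the invariant differentials of an abelian scheme over a local base, ★
`GroupSchemes/CotangentSheafFreeOverLocalRing`), an AFFINE open `V ≤ W`, a ring map `ψ : Γ(V, 𝒪_X) → C` (the chart of a
morphism `Spec C → V`) and a `C`-module `N`, every map `δ : Γ(V, 𝒪_X) → N` which is additive, LEIBNIZ along `ψ`
(`δ(ab) = ψ(a) δ(b) + ψ(b) δ(a)`) and kills the constants `S` has unique COORDINATES `c : I → N`: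
`δ(a) = ∑_i ψ(λ_i(da)) · c_i`, where `λ_i(da) ∈ Γ(V, 𝒪_X)` are the coordinates of the exact form `da` in the frame
(`Modules.coord e`).  This is Hartshorne II.8 «`Der_A(B, M) = Hom_B(Ω_{B/A}, M)`» (p. 172) read through
«`Ω_{X/Y}|_U = (Ω_{B/A})~`» (Rem. 8.9.2) for a FREE `Ω¹`: `Hom_B(B^I, M) = M^I`.

* §1 coordinates of exact forms commute with restriction; coordinates of the restricted basis sections;
* §2 **uniqueness, tested on the restrictions of the exact forms of a BIGGER affine open** (`coords_ext_of_map`): if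
  two coordinate vectors `c, c' : I → N` over an open `V' ≤ V` give the same values on all `d(a|_{V'})`, `a ∈ Γ(V, 𝒪_X)`
  (`V` affine), then `c = c'` — because `Γ(V, Ω¹)` is spanned by the `da` (★ `span_range_dSection_eq_top`), so the
  restricted basis sections lie in the `Γ(V', 𝒪)`-span of the `d(a|_{V'})`.  This is the form in which the
  coordinates are NATURAL under shrinking the target chart and under maps of coefficient modules (§4);
* §3 **existence** (`exists_coords_of_leibniz`, via Mathlib `Derivation.liftKaehlerDifferential` transported along ★
  `bijective_toCotangentSheaf_app_holds`) and **realisation** of every coordinate vector by a Leibniz map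
  (`sum_coord_dSection_add/mul/constToPresheaf_app`);
* §4 corollaries: naturality of coordinates along a restriction `V' ≤ V` with a compatible map of coefficients;
* a global trivialisation `Ω¹ ≅ 𝒪^I` gives a frame over every open: ★ `Motives.nonempty_free_iso_over_of_iso_free`
  (`Motives/HodgeSheavesFree`).

Consumer: the Čech class of the obstruction to lifting a morphism into a target with free `Ω¹` ([SGA1] III 5.1,
[MumfordFogartyKirwan1994] Prop. 6.15), where the difference of two local lifts is a Leibniz map along the chart with
values in `J·C` and its coordinates are the components of a Čech `1`-cochain of `𝒪`.
HC_CM is proved only modulo the 7 printed citations until rung 0 closes; this file discharges none of them.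

## References
* [Hartshorne1977] R. Hartshorne, *Algebraic Geometry*, GTM 52 (1977): II.8 p. 172 (`Der_A(B,M) = Hom_B(Ω_{B/A}, M)`),
  II Remark 8.9.2 (p. 176), II Prop. 5.2 (p. 110), II §5 p. 109 (free modules).
* [MumfordFogartyKirwan1994] D. Mumford, J. Fogarty, F. Kirwan, *Geometric Invariant Theory*, 3rd ed. (1994), Ch. 6 §3
  Prop. 6.15 (pp. 124–125) — the consumer («`μ̄^*𝒯 ⊗ I`» with `𝒯` free).
-/

noncomputable section

-- `TopCat.Presheaf`/`Scheme.Modules` are not reducible (as in Mathlib's `AlgebraicGeometry/Modules` and the ★ inputs).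
set_option backward.isDefEq.respectTransparency false

open CategoryTheory AlgebraicGeometry Opposite TopologicalSpace

universe u

namespace Literature.AlgebraicGeometry.HodgeTheory

open Literature.AlgebraicGeometry.Modules Literature.AlgebraicGeometry.Motives

variable {S : Type u} [CommRing S] {X : Over (Spec (CommRingCat.of S))} {W V V' : X.left.Opens} {I : Type u}
  (e : SheafOfModules.free I ≅ (cotangentSheaf X).over W)

/-! ### §1 Coordinates of exact forms and of the basis sections -/

/-- Coordinates in a frame are additive in the section. [cite: Hartshorne1977, II §5 (pp. 109–110)] -/
theorem coord_add (k : V ⟶ W) (s t : Γ(cotangentSheaf X, V)) (i : I) :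
    coord e k (s + t) i = coord e k s i + coord e k t i := by
  rw [coord_def, coord_def, coord_def, appLE_add_right]

/-- Coordinates in a frame are `Γ(V, 𝒪)`-linear in the section. [cite: Hartshorne1977, II §5 (pp. 109–110)] -/
theorem coord_smul (k : V ⟶ W) (r : Γ(X.left, V)) (s : Γ(cotangentSheaf X, V)) (i : I) :
    coord e k (r • s) i = r * coord e k s i := by
  rw [coord_def, coord_def, appLE_smul_right]
  rfl

/-- Coordinates commute with restriction: `λ_i(s|_{V'}) = λ_i(s)|_{V'}`. [cite: Hartshorne1977, II §5 (pp. 109–110)] -/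
theorem coord_map (k : V ⟶ W) (l : V' ⟶ V) (s : Γ(cotangentSheaf X, V)) (i : I) :
    coord e (l ≫ k) ((cotangentSheaf X).presheaf.map l.op s) i = X.left.presheaf.map l.op (coord e k s i) := by
  rw [coord_def, coord_def, appLE_map]
  rfl

/-- **Coordinates of exact forms commute with restriction**: `λ_i(d(a|_{V'})) = λ_i(da)|_{V'}`.
[cite: Hartshorne1977, II.8 p. 175 (compatibility of `d` with localisation)] -/
theorem coord_dSection_map (k : V ⟶ W) (l : V' ⟶ V) (a : Γ(X.left, V)) (i : I) :
    coord e (l ≫ k) (dSection X V' (X.left.presheaf.map l.op a)) i =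
      X.left.presheaf.map l.op (coord e k (dSection X V a) i) := by
  rw [← map_dSection, coord_map]

/-- Coordinates of the restricted basis sections: `λ_i(b_j|_V) = δ_{ij}`. [cite: Hartshorne1977, II §5 p. 109] -/
theorem coord_map_basisSection [DecidableEq I] (k : V ⟶ W) (i j : I) :
    coord e k ((cotangentSheaf X).presheaf.map k.op (basisSection e j)) i = if j = i then 1 else 0 := by
  have h := coord_map e (𝟙 W) k (basisSection e j) i
  rw [Category.comp_id] at h
  rw [h, coord_basisSection]
  split_ifs
  · exact map_one (X.left.presheaf.map k.op).hom
  · exact map_zero (X.left.presheaf.map k.op).hom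

/-! ### §2 Uniqueness of coordinates, tested on the restrictions of the exact forms of a bigger affine open -/

section Uniqueness

variable [Fintype I] {C : Type*} [CommRing C] {N : Type*} [AddCommGroup N] [Module C N]

/-- The coordinate pairing `ω ↦ ∑_i ψ(λ_i(ω|_{V'})) · c_i` on `Γ(V, Ω¹)` agrees for two coordinate vectors `c, c'` on
the whole `Γ(V, 𝒪)`-span of a set of forms as soon as it agrees on the set. [cite: Hartshorne1977, II §5 (pp. 109–110)] -/
theorem sum_coord_map_smul_eq_of_mem_span (k : V ⟶ W) (l : V' ⟶ V) (ψ : Γ(X.left, V') →+* C)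
    {c c' : I → N} {T : Set Γ(cotangentSheaf X, V)}
    (h : ∀ ω ∈ T, ∑ i, ψ (coord e (l ≫ k) ((cotangentSheaf X).presheaf.map l.op ω) i) • c i =
      ∑ i, ψ (coord e (l ≫ k) ((cotangentSheaf X).presheaf.map l.op ω) i) • c' i)
    {ω : Γ(cotangentSheaf X, V)} (hω : ω ∈ Submodule.span Γ(X.left, V) T) :
    ∑ i, ψ (coord e (l ≫ k) ((cotangentSheaf X).presheaf.map l.op ω) i) • c i =
      ∑ i, ψ (coord e (l ≫ k) ((cotangentSheaf X).presheaf.map l.op ω) i) • c' i := by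
  induction hω using Submodule.span_induction with
  | mem y hy => exact h y hy
  | zero =>
    have h0 : ∀ i, coord e (l ≫ k) (0 : Γ(cotangentSheaf X, V')) i = 0 := fun i => by
      rw [coord_def, appLE_zero_right]
    simp only [map_zero, h0, zero_smul, Finset.sum_const_zero]
  | add y z _ _ hy hz =>
    simp only [map_add, coord_add, Finset.sum_add_distrib, add_smul]
    rw [hy, hz]
  | smul r y _ hy =>
    simp only [Scheme.Modules.map_smul, coord_smul, map_mul, mul_smul, ← Finset.smul_sum]
    rw [hy]

/-- **Uniqueness of coordinates, tested on the restricted exact forms of a bigger affine open.**  `V` AFFINE,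
`V' ≤ V ≤ W`, `ψ : Γ(V', 𝒪_X) → C` a ring map, `N` a `C`-module: if `c, c' : I → N` satisfy
`∑_i ψ(λ_i(d(a|_{V'}))) · c_i = ∑_i ψ(λ_i(d(a|_{V'}))) · c'_i` for every `a ∈ Γ(V, 𝒪_X)`, then `c = c'`.  (The `da` span
`Γ(V, Ω¹)` over `Γ(V, 𝒪)` on the affine `V`, so the restricted basis sections `b_j|_{V'}` are reached, and
`λ_i(b_j|) = δ_{ij}`.) [cite: Hartshorne1977, II Remark 8.9.2 (p. 176) and II.8 p. 172] -/
theorem coords_ext_of_map (hV : IsAffineOpen V) (k : V ⟶ W) (l : V' ⟶ V) (ψ : Γ(X.left, V') →+* C)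
    {c c' : I → N}
    (h : ∀ a : Γ(X.left, V),
      ∑ i, ψ (coord e (l ≫ k) (dSection X V' (X.left.presheaf.map l.op a)) i) • c i =
        ∑ i, ψ (coord e (l ≫ k) (dSection X V' (X.left.presheaf.map l.op a)) i) • c' i) :
    c = c' := by
  classical
  funext j
  -- the pairing agrees on the span of the `da`, i.e. on all of `Γ(V, Ω¹)`
  have hall : ∀ ω : Γ(cotangentSheaf X, V),
      ∑ i, ψ (coord e (l ≫ k) ((cotangentSheaf X).presheaf.map l.op ω) i) • c i =
        ∑ i, ψ (coord e (l ≫ k) ((cotangentSheaf X).presheaf.map l.op ω) i) • c' i := by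
    intro ω
    refine sum_coord_map_smul_eq_of_mem_span e k l ψ (T := Set.range (dSection X V)) ?_ ?_
    · rintro _ ⟨a, rfl⟩
      rw [map_dSection]
      exact h a
    · rw [span_range_dSection_eq_top X hV]
      exact Submodule.mem_top
  -- evaluate on the restricted basis section `b_j|_V`
  have hj := hall ((cotangentSheaf X).presheaf.map k.op (basisSection e j))
  rw [presheaf_map_map] at hj
  simp only [coord_map_basisSection, apply_ite ψ, map_one, map_zero, ite_smul, one_smul, zero_smul,
    Finset.sum_ite_eq, Finset.mem_univ, if_true] at hj
  exact hj

/-- **Uniqueness of coordinates** (the case `V' = V`): two coordinate vectors with the same pairing against all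
exact forms `da`, `a ∈ Γ(V, 𝒪_X)` (`V` affine), are equal. [cite: Hartshorne1977, II.8 p. 172 and Remark 8.9.2] -/
theorem coords_ext (hV : IsAffineOpen V) (k : V ⟶ W) (ψ : Γ(X.left, V) →+* C) {c c' : I → N}
    (h : ∀ a : Γ(X.left, V),
      ∑ i, ψ (coord e k (dSection X V a) i) • c i = ∑ i, ψ (coord e k (dSection X V a) i) • c' i) :
    c = c' := by
  refine coords_ext_of_map e hV k (𝟙 V) ψ fun a => ?_
  have ha : X.left.presheaf.map (𝟙 V).op a = a := structurePresheaf_map_id a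
  simpa only [Category.id_comp, ha] using h a

end Uniqueness

/-! ### §3 Existence of coordinates; every coordinate vector is realised by a Leibniz map -/

section Existence

variable [Fintype I] {C : Type*} [CommRing C] {N : Type*} [AddCommGroup N] [Module C N]

/-- The coordinate pairing is additive in `a`. [cite: Hartshorne1977, II §8 (p. 172)] -/
theorem sum_coord_dSection_add (k : V ⟶ W) (ψ : Γ(X.left, V) →+* C) (c : I → N) (a b : Γ(X.left, V)) :
    ∑ i, ψ (coord e k (dSection X V (a + b)) i) • c i =
      ∑ i, ψ (coord e k (dSection X V a) i) • c i + ∑ i, ψ (coord e k (dSection X V b) i) • c i := by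
  simp only [dSection_add, coord_add, map_add, add_smul, Finset.sum_add_distrib]

/-- **The coordinate pairing is a Leibniz map along `ψ`**: `δ(ab) = ψ(a) δ(b) + ψ(b) δ(a)` for
`δ(a) = ∑_i ψ(λ_i(da)) · c_i` (`d(ab) = a db + b da`). [cite: Hartshorne1977, II.8 p. 172] -/
theorem sum_coord_dSection_mul (k : V ⟶ W) (ψ : Γ(X.left, V) →+* C) (c : I → N) (a b : Γ(X.left, V)) :
    ∑ i, ψ (coord e k (dSection X V (a * b)) i) • c i =
      ψ a • ∑ i, ψ (coord e k (dSection X V b) i) • c i + ψ b • ∑ i, ψ (coord e k (dSection X V a) i) • c i := by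
  simp only [dSection_mul, coord_add, coord_smul, map_add, map_mul, add_smul, mul_smul, Finset.sum_add_distrib,
    Finset.smul_sum]

/-- The coordinate pairing kills the constants `S`. [cite: Hartshorne1977, II.8 p. 172] -/
theorem sum_coord_dSection_constToPresheaf_app (k : V ⟶ W) (ψ : Γ(X.left, V) →+* C) (c : I → N) (s : S) :
    ∑ i, ψ (coord e k (dSection X V ((constToPresheaf X).app (op V) s)) i) • c i = 0 := by
  have h0 : ∀ i, coord e k (dSection X V ((constToPresheaf X).app (op V) s)) i = 0 := fun i => by
    rw [dSection_constToPresheaf_app, coord_def, appLE_zero_right]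
  simp only [h0, map_zero, zero_smul, Finset.sum_const_zero]

/-- **Existence of coordinates** ([Hartshorne1977] II.8 p. 172: `Der_A(B, M) = Hom_B(Ω_{B/A}, M)`, with
`Γ(V, Ω¹) = Ω_{Γ(V)/S}` on the affine `V` (Rem. 8.9.2) free on the `b_i|_V`).  For `V ≤ W` affine, a ring map
`ψ : Γ(V, 𝒪_X) → C`, a `C`-module `N` and `δ : Γ(V, 𝒪_X) → N` additive, Leibniz along `ψ` and vanishing on the constants
`S`, there is `c : I → N` with `δ(a) = ∑_i ψ(λ_i(da)) · c_i` for all `a` (namely `c_i = δ̃(b_i|_V)` for the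
`Γ(V)`-linear extension `δ̃` of `δ` to `Γ(V, Ω¹)`); it is unique by `coords_ext`.
[cite: Hartshorne1977, II.8 p. 172 and Remark 8.9.2 (p. 176)] -/
theorem exists_coords_of_leibniz (hV : IsAffineOpen V) (k : V ⟶ W) (ψ : Γ(X.left, V) →+* C)
    (δ : Γ(X.left, V) → N) (hadd : ∀ a b, δ (a + b) = δ a + δ b)
    (hmul : ∀ a b, δ (a * b) = ψ a • δ b + ψ b • δ a)
    (hconst : ∀ s : S, δ ((constToPresheaf X).app (op V) s) = 0) :
    ∃ c : I → N, ∀ a, δ a = ∑ i, ψ (coord e k (dSection X V a) i) • c i := by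
  classical
  -- `Γ(V, 𝒪)` as an `S`-algebra and `N` as a `Γ(V, 𝒪)`-module through `ψ`
  letI algV : Algebra S Γ(X.left, V) :=
    (((constToPresheaf X).app (op V)).hom : S →+* Γ(X.left, V)).toAlgebra
  have halg : ∀ s : S, algebraMap S Γ(X.left, V) s = (constToPresheaf X).app (op V) s := fun _ => rfl
  letI modN : Module Γ(X.left, V) N := Module.compHom N ψ
  have hsmulN : ∀ (a : Γ(X.left, V)) (n : N), a • n = ψ a • n := fun _ _ => rfl
  letI modSN : Module S N := Module.compHom N (ψ.comp (algebraMap S Γ(X.left, V)))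
  have hsmulSN : ∀ (s : S) (n : N), s • n = ψ (algebraMap S Γ(X.left, V) s) • n := fun _ _ => rfl
  haveI : IsScalarTower S Γ(X.left, V) N := ⟨fun s a n => by
    rw [hsmulN, hsmulSN, hsmulN, Algebra.smul_def, map_mul, mul_smul]⟩
  -- `δ` as an `S`-derivation `Γ(V, 𝒪) → N`
  let Dₗ : Γ(X.left, V) →ₗ[S] N :=
    { toFun := δ
      map_add' := hadd
      map_smul' := fun s a => by
        rw [RingHom.id_apply, Algebra.smul_def, hmul, halg, hconst, smul_zero, add_zero, hsmulSN, halg] }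
  let Dd : Derivation S Γ(X.left, V) N :=
    Derivation.mk' Dₗ fun a b => by
      change δ (a * b) = a • δ b + b • δ a
      rw [hsmulN, hsmulN]
      exact hmul a b
  have hDd : ∀ a, Dd a = δ a := fun _ => rfl
  have hℓ₀ : ∀ a, Dd.liftKaehlerDifferential (KaehlerDifferential.D S Γ(X.left, V) a) = δ a := fun a => by
    rw [Derivation.liftKaehlerDifferential_comp_D, hDd]
  -- transport along the bijection `ev : Ω_{Γ(V)/S} → Γ(V, Ω¹)`
  let ev : Ω[Γ(X.left, V)⁄S] → Γ(cotangentSheaf X, V) := fun ζ => (toCotangentSheaf X).app (op V) ζ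
  have hev_add : ∀ ζ ζ' : Ω[Γ(X.left, V)⁄S], ev (ζ + ζ') = ev ζ + ev ζ' := fun ζ ζ' =>
    ((toCotangentSheaf X).app (op V)).hom.map_add ζ ζ'
  have hev_smul : ∀ (r : Γ(X.left, V)) (ζ : Ω[Γ(X.left, V)⁄S]), ev (r • ζ) = r • ev ζ := fun r ζ =>
    ((toCotangentSheaf X).app (op V)).hom.map_smul r ζ
  have hev_d : ∀ a : Γ(X.left, V), ev (KaehlerDifferential.D S Γ(X.left, V) a) = dSection X V a := fun _ => rfl
  have hbij : Function.Bijective ev := bijective_toCotangentSheaf_app_holds X hV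
  obtain ⟨g, hlg, hrg⟩ := Function.bijective_iff_has_inverse.mp hbij
  have hrg' : ∀ ω, ev (g ω) = ω := hrg
  have hg_add : ∀ ω ω' : Γ(cotangentSheaf X, V), g (ω + ω') = g ω + g ω' := fun ω ω' =>
    hbij.1 (by rw [hrg', hev_add, hrg', hrg'])
  have hg_smul : ∀ (r : Γ(X.left, V)) (ω : Γ(cotangentSheaf X, V)), g (r • ω) = r • g ω := fun r ω =>
    hbij.1 (by rw [hrg', hev_smul, hrg'])
  have hg_d : ∀ a : Γ(X.left, V), g (dSection X V a) = KaehlerDifferential.D S Γ(X.left, V) a := fun a =>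
    hbij.1 (by rw [hrg', hev_d])
  -- the `Γ(V)`-linear extension `L` of `δ` to `Γ(V, Ω¹)` and its values on the basis sections
  let L : Γ(cotangentSheaf X, V) → N := fun ω => Dd.liftKaehlerDifferential (g ω)
  have hL_add : ∀ ω ω', L (ω + ω') = L ω + L ω' := fun ω ω' => by
    change Dd.liftKaehlerDifferential (g (ω + ω')) = _
    rw [hg_add, map_add]
  have hL_smul : ∀ (r : Γ(X.left, V)) ω, L (r • ω) = ψ r • L ω := fun r ω => by
    change Dd.liftKaehlerDifferential (g (r • ω)) = _
    rw [hg_smul, map_smul, hsmulN]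
  have hL_sum : ∀ (f : I → Γ(cotangentSheaf X, V)), L (∑ i, f i) = ∑ i, L (f i) := fun f =>
    map_sum (AddMonoidHom.mk' L hL_add) f Finset.univ
  have hL_d : ∀ a, L (dSection X V a) = δ a := fun a => by
    change Dd.liftKaehlerDifferential (g (dSection X V a)) = δ a
    rw [hg_d, hℓ₀]
  refine ⟨fun i => L ((cotangentSheaf X).presheaf.map k.op (basisSection e i)), fun a => ?_⟩
  rw [← hL_d, eq_sum_coord_smul e k (dSection X V a), hL_sum]
  refine Finset.sum_congr rfl fun i _ => ?_
  rw [hL_smul]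
  -- the two expansions have literally the same coordinates (`eq_sum_coord_smul` rewrote inside `coord` as well)
  rw [← eq_sum_coord_smul e k (dSection X V a)]

/-- **Existence and uniqueness of coordinates** of a Leibniz map along a chart, packaged.
[cite: Hartshorne1977, II.8 p. 172 and Remark 8.9.2 (p. 176)] -/
theorem existsUnique_coords_of_leibniz (hV : IsAffineOpen V) (k : V ⟶ W) (ψ : Γ(X.left, V) →+* C)
    (δ : Γ(X.left, V) → N) (hadd : ∀ a b, δ (a + b) = δ a + δ b)
    (hmul : ∀ a b, δ (a * b) = ψ a • δ b + ψ b • δ a)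
    (hconst : ∀ s : S, δ ((constToPresheaf X).app (op V) s) = 0) :
    ∃! c : I → N, ∀ a, δ a = ∑ i, ψ (coord e k (dSection X V a) i) • c i := by
  obtain ⟨c, hc⟩ := exists_coords_of_leibniz e hV k ψ δ hadd hmul hconst
  exact ⟨c, hc, fun c' hc' => coords_ext e hV k ψ fun a => by rw [← hc' a, hc a]⟩

end Existence

/-! ### §4 Naturality of coordinates under restriction of the chart and change of coefficients -/

section Naturality

variable [Fintype I] {C C' : Type*} [CommRing C] [CommRing C'] {N N' : Type*} [AddCommGroup N] [Module C N]
  [AddCommGroup N'] [Module C' N']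

/-- **Naturality of coordinates.**  `V` affine, `V' ≤ V ≤ W`; charts `ψ : Γ(V, 𝒪) → C`, `ψ' : Γ(V', 𝒪) → C'`
intertwined by a ring map `u : C → C'` (`ψ'(a|_{V'}) = u(ψ(a))`); coefficient modules `N`, `N'` with an additive
`f : N → N'` satisfying `f(x · n) = u(x) · f(n)`.  If `δ` on `Γ(V, 𝒪)` has coordinates `c` and `δ'` on `Γ(V', 𝒪)` has
coordinates `c'`, and `δ'(a|_{V'}) = f(δ(a))` for all `a ∈ Γ(V, 𝒪)`, then `c' = f ∘ c`.  (Used for: restriction of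
the source chart `Spec C' → Spec C`, shrinking of the target open `V' ≤ V`, and inclusion of coefficient ideals.)
[cite: Hartshorne1977, II.8 p. 175 (compatibility of `Ω` with localisation) and p. 172] -/
theorem coords_map_eq (hV : IsAffineOpen V) (k : V ⟶ W) (l : V' ⟶ V) (ψ : Γ(X.left, V) →+* C)
    (ψ' : Γ(X.left, V') →+* C') (u : C →+* C') (hu : ∀ a : Γ(X.left, V), ψ' (X.left.presheaf.map l.op a) = u (ψ a))
    (f : N →+ N') (hf : ∀ (x : C) (n : N), f (x • n) = u x • f n)
    {δ : Γ(X.left, V) → N} {c : I → N} (hc : ∀ a, δ a = ∑ i, ψ (coord e k (dSection X V a) i) • c i)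
    {δ' : Γ(X.left, V') → N'} {c' : I → N'}
    (hc' : ∀ a', δ' a' = ∑ i, ψ' (coord e (l ≫ k) (dSection X V' a') i) • c' i)
    (hδ : ∀ a : Γ(X.left, V), δ' (X.left.presheaf.map l.op a) = f (δ a)) :
    c' = fun i => f (c i) := by
  refine coords_ext_of_map e hV k l ψ' fun a => ?_
  rw [← hc', hδ, hc, map_sum]
  refine Finset.sum_congr rfl fun i _ => ?_
  rw [hf, coord_dSection_map, hu]

end Naturality

end Literature.AlgebraicGeometry.HodgeTheory

end
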